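import Summits.BirchSwinnertonDyer.BirchSwinnertonDyer.Theorems.ThetaPartnerAtTwoSignedKatoUpToAtTwoFlatEqualsPlusOfHonda
import Summits.BirchSwinnertonDyer.BirchSwinnertonDyer.Theorems.ThetaPartnerAtTwoSignedKatoUpToAtTwoLocalTwoPlusColemanKernel
import HarnessLib

/-!
# Route `ThetaPartnerAtTwo` (TP2), crux K3 `SignedKatoDivisibilityUpToAtTwo` (item stmt-BirchSwinnertonDyer-20308),
# line `colemanrat` — file 23: **CURRENCY BRIDGE to the `bsd-2adic` cell's ♭ line** (`Cruxes.SupersingularRankZeroAtTwo.FlatUniformTwo`,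
# crux stmt-BirchSwinnertonDyer-19097, line `flat_uniform_two`): the K4 Honda system at `a_2 = 0` WITNESSES that line's Honda₂ clauses
# (levels · Sprung's trace relation `Tr_{n+1/n} c_{n+1} = a_2•c_n − c_{n−1}` · DUAL level-`0` generation), and for it Sprung's `Sel♭`/`X♭`
# typed at `ap := W.frobeniusTrace 2` (that line's spelling) ARE Kobayashi's `Sel⁺`/`X⁺` (K3's objects); for ANY datum `(g, c)` of
# that line's shape, `Sel♭(c) ≤ Sel⁺`

Width seat `bsd-wall-tp2-p2x-w2` g2 (cell `bsd-wall`). HONEST FRAMING: THEOREMS ONLY — no definition, no named fact, no instance, no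
`sorry`; route-independent (no `Theses`/`Cruxes` import: the 19097 clause shapes are RESTATED verbatim, not imported); closes no item;
BSD is NOT proved by any of this.

## Why this file

Files 19–22 reduce K3 to the ♭-Kato divisibility off `2` for Sprung's `X♭` at `a_2 = 0`, and file 21 shows `Sel⁺ = Sel♭`, `X♭ ≃ X⁺` for the
K4 Honda system `d`. The `bsd-2adic` cell's line `flat_uniform_two` (stub `stub_allFlatData`) asks, for every good-supersingular `W`, for
`∃ (g, c)` at `v ∋ 2` with: `g` a local lift; (levels) `c_n ∈ E(ℚ_{n,v})`; (trace) `Tr_{n+1/n} c_{n+1} = a_2(W)•c_n − c_{n−1}` (`n ≥ 1`);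
(dual gen₀) `z₀(c_0) = 0 ⇒ z₀ = 0` for functionals of `E(ℚ_v)` and `2`-saturation of `z₀ ↦ z₀(c_0)`; then COUNT♭ and the CK♭ package on
`SharpFlatSelmerDualData W κ γ (closureEmb ℚ_v) (W.frobeniusTrace 2) g c .flat`. This file shows that on the `a_2 = 0` sub-row (208 of
that cell's 757 classes) the K4 system supplies the Honda₂ conjuncts AS THEOREMS, and that for this witness the ♭ objects of the 19097 line
and the `+` objects of K3 coincide — so ONE research statement (♭-Kato divisibility off `2` at `a_2 = 0`, stated on either cell's objects)
serves both cruxes. The only formal gap between the two spellings, `ap := W.frobeniusTrace 2` versus the literal `0` of files 16–22, is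
closed by substitution.

## What is proved

* §1 (any `K`, `p`, `κ`, `K_v`, `ι`) clause algebra: `sprungTrace_of_trace` / `trace_of_sprungTrace` ((TR) ⟺ Sprung's trace relation at
  `ap = 0`); `eq_zero_of_evalOn_eq_zero_of_gen0` (dual gen₀ (a) from (GEN₀), Nakayama on the value group);
  `exists_evalOn_eq_of_evalOn_eq_mul_of_gen0` (dual gen₀ (b): `p`-saturation of evaluation at `d_0`, from (GEN₀)).
* §2 (`K = ℚ`, `p = 2`) `sharpFlatSelmerInfty_frobeniusTrace_eq` (the two spellings agree when `a_2 = 0`);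
  **`exists_flatLineHondaData_two`** — for `W` glob. min. elliptic, `GoodSS W 2`, `a_2 = 0`, cyclotomic `κ`, `v ∋ 2`: `∃ (g, c)` with the
  19097 line's five Honda₂ conjuncts VERBATIM in shape; **`flatLine_sharpFlat_signed_agree_two`** — for any lift `g`: `∃ c` (those conjuncts)
  with `signedSelmerInfty W κ 1 = sharpFlatSelmerInfty W κ (closureEmb ℚ_v) (W.frobeniusTrace 2) g c .flat` and, for every `γ`, `D`, and
  `D♭ : SharpFlatSelmerDualData W κ γ (closureEmb ℚ_v) (W.frobeniusTrace 2) g c .flat`: `D♭.X ≃ₗ[Λ] D.X`, equal `ℓ_𝔭`, equal `Char`, torsion ↔;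
  `flatLine_sharpFlatSelmerInfty_le_signedSelmerInfty_two` — for ANY `(g, c)` with (levels) and Sprung's trace relation: `Sel♭(c) ≤ Sel⁺`.

References: [Kobayashi2003] Def. 1.1, §8.4, Prop. 8.18–8.23; [Sprung2012] Thm. 2.2 (2′), Def. 3.1, Def. 7.9–7.11, Thm. 7.14;
[KuriharaOtsuki2006] p. 557.
-/

set_option autoImplicit false
-- the Theorems namespace of this sub repeats the summit name by design (D-0017 nested layout)
set_option linter.dupNamespace false

noncomputable section

open scoped Classical NumberField

universe u

namespace Summit.BirchSwinnertonDyer.BirchSwinnertonDyer.Theorems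

namespace SignedKatoOffTwo.FlatKernel

open NumberField IsDedekindDomain WeierstrassCurve Literature.NumberTheory.EllipticCurves
  Literature.NumberTheory.GaloisRepresentations Literature.NumberTheory.EllipticCurves.ZpExtension
  Literature.NumberTheory.EllipticCurves.Kobayashi2003 Literature.NumberTheory.EllipticCurves.Sprung2017
  Literature.NumberTheory.EllipticCurves.Sprung2012 Literature.NumberTheory.EllipticCurves.Rank1Residual
  Literature.NumberTheory.EllipticCurves.Module

/-! ## §1 Clause algebra (any base) -/

section Clauses

variable {K : Type u} [Field K] {p : ℕ} [hp : Fact p.Prime] (κ : ZpExtension K p)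
variable {E : Type u} [Field E] [Algebra K E] (ι : AlgebraicClosure K →ₐ[K] AlgebraicClosure E)
variable (W : WeierstrassCurve K)

/-- (TR) `Tr_{m+2/m+1} d_{m+2} = −d_m` gives Sprung's trace relation `Tr_{n+1/n} d_{n+1} = a_p•d_n − d_{n−1}` (`n ≥ 1`) when `a_p = 0`.
[cite: Sprung2012, Thm. 2.2 (2′) (p. 1487)] [cite: Kobayashi2003, Def. 8.8] -/
theorem sprungTrace_of_trace {ap : ℤ} (hap : ap = 0) {d : ℕ → localPoints W E}
    (htr : ∀ m, localTraceOfEmb κ ι W (m + 1) (m + 2) (d (m + 2)) = -d m) :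
    ∀ n, 1 ≤ n → localTraceOfEmb κ ι W n (n + 1) (d (n + 1)) = ap • d n - d (n - 1) := by
  subst hap
  intro n hn
  obtain ⟨m, rfl⟩ : ∃ m, n = m + 1 := ⟨n - 1, by omega⟩
  rw [zero_smul, zero_sub, Nat.add_sub_cancel]
  exact htr m

/-- Sprung's trace relation at `a_p = 0` gives (TR). [cite: Sprung2012, Thm. 2.2 (2′) (p. 1487)] [cite: Kobayashi2003, Def. 8.8] -/
theorem trace_of_sprungTrace {ap : ℤ} (hap : ap = 0) {d : ℕ → localPoints W E}
    (h : ∀ n, 1 ≤ n → localTraceOfEmb κ ι W n (n + 1) (d (n + 1)) = ap • d n - d (n - 1)) :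
    ∀ m, localTraceOfEmb κ ι W (m + 1) (m + 2) (d (m + 2)) = -d m := by
  subst hap
  intro m
  have := h (m + 1) (Nat.le_add_left 1 m)
  rwa [zero_smul, zero_sub, Nat.add_sub_cancel] at this

/-- **Dual level-`0` generation (a) from (GEN₀)**: if every `P ∈ E(K_v)` is `a•d_0 + p•R` (`a ∈ ℤ`, `R ∈ E(K_v)`), a functional
`z₀ : E(K_v) → ℤ_p` with `z₀(d_0) = 0` vanishes — its value group `S` satisfies `S ⊆ pS`, hence `S = 0` (Nakayama in `ℤ_p`,
`LocalTwo.AddSubgroup.eq_bot_of_le_prime_mul`). [cite: Sprung2012, Thm. 2.2 (2′) and Def. 3.1] [cite: Kobayashi2003, Prop. 8.12] -/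
theorem eq_zero_of_evalOn_eq_zero_of_gen0 {d : ℕ → localPoints W E} (hd0 : d 0 ∈ localLayerPointsOfEmb κ ι W 0)
    (hgen0 : ∀ P ∈ localLayerPointsOfEmb κ ι W 0, ∃ a : ℤ, ∃ R ∈ localLayerPointsOfEmb κ ι W 0, P = a • d 0 + p • R)
    (z₀ : localLayerPointsOfEmb κ ι W 0 →+ ℤ_[p]) (hz : evalOn W (localLayerPointsOfEmb κ ι W 0) z₀ (d 0) = 0) :
    z₀ = 0 := by
  rw [evalOn_of_mem W _ z₀ hd0] at hz
  have hS : z₀.range = ⊥ := by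
    refine LocalTwo.AddSubgroup.eq_bot_of_le_prime_mul _ fun x hx => ?_
    obtain ⟨P, rfl⟩ := AddMonoidHom.mem_range.mp hx
    obtain ⟨a, R, hR, hP⟩ := hgen0 P P.2
    have hP' : P = a • (⟨d 0, hd0⟩ : localLayerPointsOfEmb κ ι W 0) + p • ⟨R, hR⟩ :=
      Subtype.ext (by rw [AddSubgroup.coe_add, AddSubgroupClass.coe_zsmul, AddSubgroupClass.coe_nsmul]; exact hP)
    refine ⟨z₀ ⟨R, hR⟩, AddMonoidHom.mem_range.mpr ⟨⟨R, hR⟩, rfl⟩, ?_⟩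
    rw [hP', map_add, map_zsmul, map_nsmul, hz, smul_zero, zero_add, nsmul_eq_mul]
  ext P
  have hmem : z₀ P ∈ z₀.range := AddMonoidHom.mem_range.mpr ⟨P, rfl⟩
  rw [hS, AddSubgroup.mem_bot] at hmem
  rw [hmem, AddMonoidHom.zero_apply]

/-- **Dual level-`0` generation (b) from (GEN₀)**: evaluation at `d_0` has `p`-saturated image — if `z₀(d_0) = p·a` for some functional
`z₀` of `E(K_v)`, then `y(d_0) = a` for some functional `y`: by (GEN₀) every value of `z₀` is divisible by `p`, and `y := z₀/p` is
additive (`ℤ_p` is a domain). [cite: Sprung2012, Thm. 2.2 (2′) and Def. 3.1] [cite: Kobayashi2003, Prop. 8.12] -/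
theorem exists_evalOn_eq_of_evalOn_eq_mul_of_gen0 {d : ℕ → localPoints W E} (hd0 : d 0 ∈ localLayerPointsOfEmb κ ι W 0)
    (hgen0 : ∀ P ∈ localLayerPointsOfEmb κ ι W 0, ∃ a : ℤ, ∃ R ∈ localLayerPointsOfEmb κ ι W 0, P = a • d 0 + p • R)
    (a : ℤ_[p])
    (h : ∃ z₀ : localLayerPointsOfEmb κ ι W 0 →+ ℤ_[p], evalOn W (localLayerPointsOfEmb κ ι W 0) z₀ (d 0) = (p : ℤ_[p]) * a) :
    ∃ y : localLayerPointsOfEmb κ ι W 0 →+ ℤ_[p], evalOn W (localLayerPointsOfEmb κ ι W 0) y (d 0) = a := by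
  obtain ⟨z₀, hz⟩ := h
  rw [evalOn_of_mem W _ z₀ hd0] at hz
  have hdiv : ∀ P : localLayerPointsOfEmb κ ι W 0, ∃ w : ℤ_[p], z₀ P = (p : ℤ_[p]) * w := by
    intro P
    obtain ⟨b, R, hR, hP⟩ := hgen0 P P.2
    have hP' : P = b • (⟨d 0, hd0⟩ : localLayerPointsOfEmb κ ι W 0) + p • ⟨R, hR⟩ :=
      Subtype.ext (by rw [AddSubgroup.coe_add, AddSubgroupClass.coe_zsmul, AddSubgroupClass.coe_nsmul]; exact hP)
    refine ⟨(b : ℤ_[p]) * a + z₀ ⟨R, hR⟩, ?_⟩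
    rw [hP', map_add, map_zsmul, map_nsmul, hz, zsmul_eq_mul, nsmul_eq_mul]
    ring
  choose w hw using hdiv
  have hp0 : (p : ℤ_[p]) ≠ 0 := Nat.cast_ne_zero.2 hp.out.ne_zero
  refine ⟨{ toFun := w
            map_zero' := mul_left_cancel₀ hp0 (by rw [← hw 0, map_zero, mul_zero])
            map_add' := fun P Q => mul_left_cancel₀ hp0 (by rw [← hw (P + Q), map_add, hw P, hw Q, mul_add]) }, ?_⟩
  rw [evalOn_of_mem W _ _ hd0]
  show w ⟨d 0, hd0⟩ = a
  exact mul_left_cancel₀ hp0 ((hw _).symm.trans hz)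

end Clauses

/-! ## §2 `K = ℚ`, `p = 2`: the 19097 line's currency -/

section Rat

variable (W : WeierstrassCurve ℚ) [W.IsElliptic] [W.IsGloballyMinimal]

omit [W.IsElliptic] in
/-- The two spellings of Sprung's `Sel♭(E/ℚ_∞)` agree when `a_2(W) = 0`: `ap := W.frobeniusTrace 2` (line `flat_uniform_two`) versus the
literal `0` (files 16–22). [cite: Sprung2012, Def. 7.11 (p. 1503)] -/
theorem sharpFlatSelmerInfty_frobeniusTrace_eq (ha : W.frobeniusTrace 2 = 0) (κ : ZpExtension ℚ 2)
    {E : Type} [Field E] [Algebra ℚ E] (ι : AlgebraicClosure ℚ →ₐ[ℚ] AlgebraicClosure E)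
    (g : Field.absoluteGaloisGroup E) (c : ℕ → localPoints W E) :
    sharpFlatSelmerInfty W κ ι (W.frobeniusTrace 2) g c .flat = sharpFlatSelmerInfty W κ ι 0 g c .flat := by
  rw [ha]

/-- **The 19097 line's Honda₂ data at `a_2 = 0`, AS A THEOREM**: for `W/ℚ` elliptic globally minimal with `GoodSS W 2`, `a_2(W) = 0`, the
cyclotomic `κ` and the place `v ∋ 2`, there are a local lift `g` of the topological generator and points `c_n` with — VERBATIM in the shape of
`FlatUniformTwo.stub_allFlatData`'s first five conjuncts — `g` a lift, (levels), Sprung's trace relation `Tr_{n+1/n} c_{n+1} = a_2(W)•c_n − c_{n−1}`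
(`n ≥ 1`), and dual level-`0` generation (a), (b). Witness: any lift `g` (`exists_isTopGenerator_resGalOfEmb_adicCompletion`) and the K4 Honda
system (file 21 `exists_plusHondaSystem_two`; (GEN₀) ⇒ dual gen₀ by §1). [cite: Sprung2012, Thm. 2.2 (2′)] [cite: Kobayashi2003, §8.4] -/
theorem exists_flatLineHondaData_two (hss : GoodSS W 2) (ha : W.frobeniusTrace 2 = 0) {κ : ZpExtension ℚ 2} (hκ : κ.IsCyclotomic)
    (v : HeightOneSpectrum (𝓞 ℚ)) (hv : (2 : 𝓞 ℚ) ∈ v.asIdeal) :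
    ∃ (g : Field.absoluteGaloisGroup (v.adicCompletion ℚ)) (c : ℕ → localPoints W (v.adicCompletion ℚ)),
      κ.IsTopGenerator (resGalOfEmb (closureEmb (K := ℚ) (v.adicCompletion ℚ)) g) ∧
      (∀ n, c n ∈ localLayerPointsOfEmb κ (closureEmb (K := ℚ) (v.adicCompletion ℚ)) W n) ∧
      (∀ n, 1 ≤ n → localTraceOfEmb κ (closureEmb (K := ℚ) (v.adicCompletion ℚ)) W n (n + 1)
        (c (n + 1)) = W.frobeniusTrace 2 • c n - c (n - 1)) ∧
      (∀ z₀ : localLayerPointsOfEmb κ (closureEmb (K := ℚ) (v.adicCompletion ℚ)) W 0 →+ ℤ_[2],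
        evalOn W (localLayerPointsOfEmb κ (closureEmb (K := ℚ) (v.adicCompletion ℚ)) W 0) z₀ (c 0) = 0 →
          z₀ = 0) ∧
      (∀ a : ℤ_[2],
        (∃ z₀ : localLayerPointsOfEmb κ (closureEmb (K := ℚ) (v.adicCompletion ℚ)) W 0 →+ ℤ_[2],
          evalOn W (localLayerPointsOfEmb κ (closureEmb (K := ℚ) (v.adicCompletion ℚ)) W 0) z₀ (c 0) =
            2 * a) →
        ∃ y : localLayerPointsOfEmb κ (closureEmb (K := ℚ) (v.adicCompletion ℚ)) W 0 →+ ℤ_[2],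
          evalOn W (localLayerPointsOfEmb κ (closureEmb (K := ℚ) (v.adicCompletion ℚ)) W 0) y (c 0) = a) := by
  obtain ⟨g, hg⟩ := hκ.exists_isTopGenerator_resGalOfEmb_adicCompletion v (by exact_mod_cast hv)
  obtain ⟨d, hd, htr, -, hgen0⟩ := exists_plusHondaSystem_two W hss ha hκ v hv
  have h2 : ((2 : ℕ) : ℤ_[2]) = 2 := by norm_num
  refine ⟨g, d, hg, hd, sprungTrace_of_trace κ _ W ha htr,
    fun z₀ hz => eq_zero_of_evalOn_eq_zero_of_gen0 κ _ W (hd 0) hgen0 z₀ hz, fun a h => ?_⟩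
  refine exists_evalOn_eq_of_evalOn_eq_mul_of_gen0 κ _ W (hd 0) hgen0 a ?_
  rw [h2]
  exact h

/-- **For the K4 witness the 19097 line's ♭ objects ARE K3's `+` objects.** For `W/ℚ` elliptic globally minimal with `GoodSS W 2`, `a_2(W) = 0`,
the cyclotomic `κ`, `v ∋ 2` and any local lift `g`: `∃ c` with (levels), Sprung's trace relation, dual gen₀ (a) (b), such that
`signedSelmerInfty W κ 1 = sharpFlatSelmerInfty W κ (closureEmb ℚ_v) (W.frobeniusTrace 2) g c .flat`, and for every `γ`, every pinned
`D : SignedSelmerDualData W κ γ 1` and every pinned `D♭ : SharpFlatSelmerDualData W κ γ (closureEmb ℚ_v) (W.frobeniusTrace 2) g c .flat` (the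
19097 line's dual datum): `D♭.X ≃ₗ[Λ] D.X`, `ℓ_𝔭(D♭.X) = ℓ_𝔭(D.X)` for all `𝔭`, `Char(D♭.X) = Char(D.X)`, `D♭.X` torsion iff `D.X` torsion
(file 21 transported along `a_2(W) = 0`). [cite: Kobayashi2003, Def. 1.1, Thm. 6.2, Prop. 8.18–8.23] [cite: Sprung2012, §1 p. 1486, Def. 7.11, Thm. 7.14] -/
theorem flatLine_sharpFlat_signed_agree_two (hss : GoodSS W 2) (ha : W.frobeniusTrace 2 = 0) {κ : ZpExtension ℚ 2}
    (hκ : κ.IsCyclotomic) (v : HeightOneSpectrum (𝓞 ℚ)) (hv : (2 : 𝓞 ℚ) ∈ v.asIdeal)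
    {g : Field.absoluteGaloisGroup (v.adicCompletion ℚ)}
    (hg : κ.IsTopGenerator (resGalOfEmb (closureEmb (K := ℚ) (v.adicCompletion ℚ)) g)) :
    ∃ c : ℕ → localPoints W (v.adicCompletion ℚ),
      (∀ n, c n ∈ localLayerPointsOfEmb κ (closureEmb (K := ℚ) (v.adicCompletion ℚ)) W n) ∧
      (∀ n, 1 ≤ n → localTraceOfEmb κ (closureEmb (K := ℚ) (v.adicCompletion ℚ)) W n (n + 1)
        (c (n + 1)) = W.frobeniusTrace 2 • c n - c (n - 1)) ∧
      (∀ z₀ : localLayerPointsOfEmb κ (closureEmb (K := ℚ) (v.adicCompletion ℚ)) W 0 →+ ℤ_[2],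
        evalOn W (localLayerPointsOfEmb κ (closureEmb (K := ℚ) (v.adicCompletion ℚ)) W 0) z₀ (c 0) = 0 →
          z₀ = 0) ∧
      (∀ a : ℤ_[2],
        (∃ z₀ : localLayerPointsOfEmb κ (closureEmb (K := ℚ) (v.adicCompletion ℚ)) W 0 →+ ℤ_[2],
          evalOn W (localLayerPointsOfEmb κ (closureEmb (K := ℚ) (v.adicCompletion ℚ)) W 0) z₀ (c 0) =
            2 * a) →
        ∃ y : localLayerPointsOfEmb κ (closureEmb (K := ℚ) (v.adicCompletion ℚ)) W 0 →+ ℤ_[2],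
          evalOn W (localLayerPointsOfEmb κ (closureEmb (K := ℚ) (v.adicCompletion ℚ)) W 0) y (c 0) = a) ∧
      signedSelmerInfty W κ 1 =
        sharpFlatSelmerInfty W κ (closureEmb (K := ℚ) (v.adicCompletion ℚ)) (W.frobeniusTrace 2) g c .flat ∧
      ∀ {γ : Field.absoluteGaloisGroup ℚ} (D : SignedSelmerDualData W κ γ 1)
        (Df : SharpFlatSelmerDualData W κ γ (closureEmb (K := ℚ) (v.adicCompletion ℚ)) (W.frobeniusTrace 2) g c .flat),
        Nonempty (Df.X ≃ₗ[IwasawaAlgebra 2] D.X) ∧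
        (∀ 𝔭 : PrimeSpectrum (IwasawaAlgebra 2), lengthAt (IwasawaAlgebra 2) Df.X 𝔭 = lengthAt (IwasawaAlgebra 2) D.X 𝔭) ∧
        Df.charIdeal = D.charIdeal ∧
        (Module.IsTorsion (IwasawaAlgebra 2) Df.X ↔ Module.IsTorsion (IwasawaAlgebra 2) D.X) := by
  obtain ⟨d, hd, htr, -, hgen0, heq, hdual⟩ := sharpFlat_signed_agree_two W hss ha hκ v hv hg
  have h2 : ((2 : ℕ) : ℤ_[2]) = 2 := by norm_num
  refine ⟨d, hd, sprungTrace_of_trace κ _ W ha htr,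
    fun z₀ hz => eq_zero_of_evalOn_eq_zero_of_gen0 κ _ W (hd 0) hgen0 z₀ hz,
    fun a h => exists_evalOn_eq_of_evalOn_eq_mul_of_gen0 κ _ W (hd 0) hgen0 a (by rw [h2]; exact h), ?_, ?_⟩
  · rw [sharpFlatSelmerInfty_frobeniusTrace_eq W ha]
    exact heq
  · -- transport of file 21's dual statements along `a_2(W) = 0`
    have key : ∀ (ap : ℤ), ap = 0 → ∀ {γ : Field.absoluteGaloisGroup ℚ} (D : SignedSelmerDualData W κ γ 1)
        (Df : SharpFlatSelmerDualData W κ γ (closureEmb (K := ℚ) (v.adicCompletion ℚ)) ap g d .flat),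
        Nonempty (Df.X ≃ₗ[IwasawaAlgebra 2] D.X) ∧
        (∀ 𝔭 : PrimeSpectrum (IwasawaAlgebra 2), lengthAt (IwasawaAlgebra 2) Df.X 𝔭 = lengthAt (IwasawaAlgebra 2) D.X 𝔭) ∧
        Df.charIdeal = D.charIdeal ∧
        (Module.IsTorsion (IwasawaAlgebra 2) Df.X ↔ Module.IsTorsion (IwasawaAlgebra 2) D.X) := by
      rintro ap rfl γ D Df
      exact hdual D Df
    intro γ D Df
    exact key _ ha D Df

/-- **`Sel♭(c) ≤ Sel⁺` for EVERY datum of the 19097 line's shape at `a_2 = 0`.** For `W/ℚ` elliptic globally minimal with `GoodSS W 2`,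
`a_2(W) = 0`, any `ℤ₂`-extension `κ`, `v ∋ 2`, a local lift `g` and points `c_n` with (levels) and Sprung's trace relation:
`sharpFlatSelmerInfty W κ (closureEmb ℚ_v) (W.frobeniusTrace 2) g c .flat ≤ signedSelmerInfty W κ 1` — the ♭ condition is never weaker than
Kobayashi's ((NT) by the tower-torsion theorem at `2`; file 20 §3). [cite: Sprung2012, Def. 7.11] [cite: Kobayashi2003, Def. 1.1] -/
theorem flatLine_sharpFlatSelmerInfty_le_signedSelmerInfty_two (hss : GoodSS W 2) (ha : W.frobeniusTrace 2 = 0) (κ : ZpExtension ℚ 2)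
    (v : HeightOneSpectrum (𝓞 ℚ)) (hv : (2 : 𝓞 ℚ) ∈ v.asIdeal) {g : Field.absoluteGaloisGroup (v.adicCompletion ℚ)}
    (hg : κ.IsTopGenerator (resGalOfEmb (closureEmb (K := ℚ) (v.adicCompletion ℚ)) g))
    {c : ℕ → localPoints W (v.adicCompletion ℚ)}
    (hc : ∀ n, c n ∈ localLayerPointsOfEmb κ (closureEmb (K := ℚ) (v.adicCompletion ℚ)) W n)
    (htr : ∀ n, 1 ≤ n → localTraceOfEmb κ (closureEmb (K := ℚ) (v.adicCompletion ℚ)) W n (n + 1)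
      (c (n + 1)) = W.frobeniusTrace 2 • c n - c (n - 1)) :
    sharpFlatSelmerInfty W κ (closureEmb (K := ℚ) (v.adicCompletion ℚ)) (W.frobeniusTrace 2) g c .flat ≤
      signedSelmerInfty W κ 1 := by
  rw [sharpFlatSelmerInfty_frobeniusTrace_eq W ha]
  exact sharpFlatSelmerInfty_flat_le_signedSelmerInfty_two W κ v hv hg
    (fun _ hP hP2 => SSFlatEC.eq_zero_of_mem_localTowerPointsOfEmb_of_two_nsmul W hss κ hv _ hP hP2) hc
    (trace_of_sprungTrace κ _ W ha htr)

end Rat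

end SignedKatoOffTwo.FlatKernel

end Summit.BirchSwinnertonDyer.BirchSwinnertonDyer.Theorems

end
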